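import Summits.AtomisticToContinuum.Crystallization.Theorems.PalmUnimodularRigidityLayeredLawsSelectHcpCertificateDefsB
import Summits.AtomisticToContinuum.Crystallization.Theorems.PalmUnimodularRigidityLayeredLawsSelectHcpRootedChartsNcard

/-!
# Crux `LayeredLawsSelectHcp` (stmt-AtomisticToContinuum-9226), line `mtp-prestress-split-ergodic-frame`:
# local charts on the near ball are the restrictions of the rooted charts

Registered sub-goal `tube_localChart_iff` of the crux item (certificate calculus, lead c2 reshape).  A LOCAL CHART
on the near ball `nearBall = {0} ∪ nearLabels` (the 57 labels of the graph ball of radius `2` of the contact graph of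
the ideal hcp `Pᵢ = hcpSite 1 √(2/3)` around the root) of a point set `S` is a labelling `z` with `z 0 = 0`, near-ball
values in `S`, injective on the near ball, and ideal unit struts ↔ bonds (`0 < dist ≤ 28/25`) on `nearBall²`
(`IsLocalChart`).  For an hcp-charted `S ∋ 0` these are EXACTLY the restrictions to the near ball of the rooted
labelled charts (`IsRootedChart`; there are twelve of them, `tube_rootedCharts_ncard`).  Pure combinatorics of the
contact graph, in the footsteps of the landed `tube_rootedChart_unique` / `tube_rootedCharts_ncard`:

* two finite label facts (by `decide`): the near ball is the union of the stars of the twelve star labels —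
  `nbr w γ ∈ nearBall` for `w, γ ∈ hcpStarIdx` (`nbr_star_mem_nearBall`) and conversely every near-ball label is
  such an `nbr w γ` (`exists_nbr_eq_of_mem_nearBall`);
* `aut_star_step_local`: the local step `RootedChartUnique.aut_star_step` for an index map `σ` known only ON THE
  NEAR BALL (injective there, unit struts preserved in both directions there) which fixes the root and the twelve
  star labels: it fixes the whole star of every star label `w` (the induced relabelling of the star of `w` is a
  touching-preserving injection of `hcpStarIdx`, hence an isometry, `stub_localCongruenceStarAut`, fixing the label
  of the root and the labels of the common neighbours of `0` and `w`, hence the identity, `star_eq_of_profile`);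
  so such a `σ` is the identity on the near ball (`eqOn_nearBall_of_fix_star`);
* `localChart_eqOn_nearBall`: a local chart `z` and a rooted chart `X` agreeing on the star agree on the near ball
  (`σ = X⁻¹ ∘ z` is such an index map);
* `tube_localChart_iff` (→): for a local chart `z` and a rooted chart `X₀` (`tube_exists_rootedChart`) the index map
  `X₀⁻¹ ∘ z` restricted to the star is an automorphism of the contact graph of the star (`autCands_complete`), i.e.
  the restriction of one of the twelve index automorphisms `A t` (`exists_hcpIndexAut`); `X₀ ∘ A t` is a rooted
  chart agreeing with `z` on the star, hence on the near ball.  (←): restriction of a rooted chart, injectivity by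
  `RootedChartUnique.chart_injective`.  (The `GoodShell` hypothesis is not used.)

All `[folklore]`.
-/

noncomputable section

namespace Summit.AtomisticToContinuum.Crystallization.Theorems.PalmUnimodularRigidity.LayeredLawsSelectHcp

open MeasureTheory Set
open Literature.MathematicalPhysics.StatisticalMechanics Literature.Geometry.DiscreteGeometry
open Summit.AtomisticToContinuum.Crystallization.Theorems.LayeredLawsSelectHcp.Negative.DiracLaws (GoodShell)

namespace LocalChartIff

open RootedChartUnique

/-! ## Two finite facts about the near ball (by `decide`) -/

/-- The star of every star label lies in the near ball: `nbr w γ ∈ nearBall` for star labels `w, γ`. [folklore] -/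
theorem nbr_starLab_mem_nearBall : ∀ m n : Fin 12, nbr (starLab m) (starLab n) ∈ nearBall := by
  decide +kernel

/-- Every near-ball label lies in the star of some star label. [folklore] -/
theorem exists_nbr_starLab_eq : ∀ u ∈ nearBall, ∃ m n : Fin 12, nbr (starLab m) (starLab n) = u := by
  decide +kernel

/-- The star of every star label lies in the near ball. [folklore] -/
theorem nbr_star_mem_nearBall {w γ : ℤ × ℤ × ℤ} (hw : w ∈ hcpStarIdx) (hγ : γ ∈ hcpStarIdx) :
    nbr w γ ∈ nearBall := by
  obtain ⟨m, rfl⟩ := exists_starLab_eq hw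
  obtain ⟨n, rfl⟩ := exists_starLab_eq hγ
  exact nbr_starLab_mem_nearBall m n

/-- Every near-ball label is a labelled neighbour `nbr w γ` of a star label `w`, `γ ∈ hcpStarIdx`. [folklore] -/
theorem exists_nbr_eq_of_mem_nearBall {u : ℤ × ℤ × ℤ} (hu : u ∈ nearBall) :
    ∃ w ∈ hcpStarIdx, ∃ γ ∈ hcpStarIdx, nbr w γ = u := by
  obtain ⟨m, n, h⟩ := exists_nbr_starLab_eq u hu
  exact ⟨starLab m, starLab_mem m, starLab n, starLab_mem n, h⟩

/-- The star labels are near-ball labels (each lies in the star of a star label touching it). [folklore] -/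
theorem mem_nearBall_of_mem_hcpStarIdx {v : ℤ × ℤ × ℤ} (hv : v ∈ hcpStarIdx) : v ∈ nearBall := by
  -- `v` lies in the star of any star label `γ₁` touching it (`star_common`)
  obtain ⟨γ₁, hγ₁, -, -, hd₁, -, -⟩ := star_common hv
  obtain ⟨l, hl, hvl⟩ := (dist_ideal_eq_one_iff_nbr γ₁ v).1 hd₁
  rw [hvl]
  exact nbr_star_mem_nearBall hγ₁ hl

/-! ## Index maps on the near ball fixing the root star are the identity there -/

/-- **The local step on the near ball.**  If `σ : ℤ³ → ℤ³` is injective on the near ball, preserves the ideal unit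
struts in both directions on the near ball, fixes the root and the twelve star labels, then it fixes the twelve
neighbours of every star label `w` (cf. `RootedChartUnique.aut_star_step`). [folklore] -/
theorem aut_star_step_local {σ : ℤ × ℤ × ℤ → ℤ × ℤ × ℤ}
    (hσ : ∀ u ∈ nearBall, ∀ z ∈ nearBall,
      (dist (hcpSite 1 (Real.sqrt (2 / 3)) (σ u)) (hcpSite 1 (Real.sqrt (2 / 3)) (σ z)) = 1 ↔
        dist (hcpSite 1 (Real.sqrt (2 / 3)) u) (hcpSite 1 (Real.sqrt (2 / 3)) z) = 1))
    (hinj : Set.InjOn σ ↑nearBall) (h0 : σ 0 = 0) (hN : ∀ ε ∈ hcpStarIdx, σ ε = ε)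
    {w : ℤ × ℤ × ℤ} (hw : w ∈ hcpStarIdx) : ∀ γ ∈ hcpStarIdx, σ (nbr w γ) = nbr w γ := by
  have hwN : w ∈ nearBall := mem_nearBall_of_mem_hcpStarIdx hw
  have hmem : ∀ γ ∈ hcpStarIdx, nbr w γ ∈ nearBall := fun γ hγ => nbr_star_mem_nearBall hw hγ
  -- the induced relabelling of the star of `w`
  have hex : ∀ γ ∈ hcpStarIdx, ∃ δ ∈ hcpStarIdx, σ (nbr w γ) = nbr w δ := fun γ hγ => by
    have h1 : dist (hcpSite 1 (Real.sqrt (2 / 3)) w) (hcpSite 1 (Real.sqrt (2 / 3)) (nbr w γ)) = 1 :=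
      (dist_ideal_eq_one_iff_nbr w _).2 ⟨γ, hγ, rfl⟩
    have h2 := (hσ w hwN (nbr w γ) (hmem γ hγ)).2 h1
    rw [hN w hw] at h2
    exact (dist_ideal_eq_one_iff_nbr w _).1 h2
  choose! π hπmem hπeq using hex
  have hπinj : Set.InjOn π ↑hcpStarIdx := fun γ hγ γ' hγ' hγγ' =>
    nbr_label_cancel (hinj (hmem γ hγ) (hmem γ' hγ') (by rw [hπeq γ hγ, hπeq γ' hγ', hγγ']))
  have hπmaps : Set.MapsTo π ↑hcpStarIdx ↑hcpStarIdx := fun γ hγ => hπmem γ hγ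
  have hπadj : ∀ γ ∈ hcpStarIdx, ∀ γ' ∈ hcpStarIdx,
      (dist (hcpSite 1 (Real.sqrt (2 / 3)) (π γ)) (hcpSite 1 (Real.sqrt (2 / 3)) (π γ')) = 1 ↔
        dist (hcpSite 1 (Real.sqrt (2 / 3)) γ) (hcpSite 1 (Real.sqrt (2 / 3)) γ') = 1) := by
    intro γ hγ γ' hγ'
    rw [← dist_nbr_nbr w (π γ) (π γ'), ← hπeq γ hγ, ← hπeq γ' hγ', hσ _ (hmem γ hγ) _ (hmem γ' hγ'),
      dist_nbr_nbr]
  have hiso := stub_localCongruenceStarAut 1 (Real.sqrt (2 / 3)) π hπinj hπmaps hπadj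
  -- the label of the root in the star of `w` and the labels touching it are fixed
  have hw0 : dist (hcpSite 1 (Real.sqrt (2 / 3)) w) (hcpSite 1 (Real.sqrt (2 / 3)) 0) = 1 := by
    rw [dist_comm]; exact (mem_hcpStarIdx_iff_dist w).1 hw
  obtain ⟨γ₀, hγ₀, h0γ⟩ := (dist_ideal_eq_one_iff_nbr w 0).1 hw0
  have hfix : ∀ l ∈ hcpStarIdx, σ (nbr w l) = nbr w l → π l = l := fun l hl hl' =>
    nbr_label_cancel (by rw [← hπeq l hl, hl'])
  have hfix0 : π γ₀ = γ₀ := hfix γ₀ hγ₀ (by rw [← h0γ, h0])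
  have hfixN : ∀ l ∈ hcpStarIdx,
      dist (hcpSite 1 (Real.sqrt (2 / 3)) γ₀) (hcpSite 1 (Real.sqrt (2 / 3)) l) = 1 → π l = l := by
    intro l hl hdl
    refine hfix l hl (hN _ ?_)
    have h1 : dist (hcpSite 1 (Real.sqrt (2 / 3)) (nbr w γ₀)) (hcpSite 1 (Real.sqrt (2 / 3)) (nbr w l)) = 1 := by
      rw [dist_nbr_nbr]; exact hdl
    rw [← h0γ] at h1
    exact (mem_hcpStarIdx_iff_dist _).2 h1
  -- so the relabelling is the identity
  intro γ hγ
  rw [hπeq γ hγ]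
  congr 1
  refine star_eq_of_profile hγ₀ (hπmem γ hγ) hγ ?_ fun l hl hdl => ?_
  · have := (hiso γ hγ γ₀ hγ₀).1
    rwa [hfix0] at this
  · have := (hiso γ hγ l hl).1
    rwa [hfixN l hl hdl] at this

/-- **An index map injective and strut-preserving on the near ball which fixes the root and the star labels is the
identity on the near ball** (the near ball is the union of the stars of the star labels). [folklore] -/
theorem eqOn_nearBall_of_fix_star {σ : ℤ × ℤ × ℤ → ℤ × ℤ × ℤ}
    (hσ : ∀ u ∈ nearBall, ∀ z ∈ nearBall,
      (dist (hcpSite 1 (Real.sqrt (2 / 3)) (σ u)) (hcpSite 1 (Real.sqrt (2 / 3)) (σ z)) = 1 ↔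
        dist (hcpSite 1 (Real.sqrt (2 / 3)) u) (hcpSite 1 (Real.sqrt (2 / 3)) z) = 1))
    (hinj : Set.InjOn σ ↑nearBall) (h0 : σ 0 = 0) (hN : ∀ ε ∈ hcpStarIdx, σ ε = ε) :
    ∀ u ∈ nearBall, σ u = u := by
  intro u hu
  obtain ⟨w, hw, γ, hγ, rfl⟩ := exists_nbr_eq_of_mem_nearBall hu
  exact aut_star_step_local hσ hinj h0 hN hw γ hγ

/-- **A local chart and a rooted chart of the same carrier which agree on the twelve star labels agree on the near
ball**: the index map `σ = X⁻¹ ∘ z` (charts are onto resp. into `S`, and injective) fixes the root and the star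
labels, is injective on the near ball and preserves the unit struts there. [folklore] -/
theorem localChart_eqOn_nearBall {S : Set (EuclideanSpace ℝ (Fin 3))}
    {z X : ℤ × ℤ × ℤ → EuclideanSpace ℝ (Fin 3)} (hz : IsLocalChart S z) (hX : IsRootedChart S X)
    (hagree : ∀ v ∈ hcpStarIdx, z v = X v) : ∀ u ∈ nearBall, z u = X u := by
  obtain ⟨hz0, hzS, hzinj, hzb⟩ := hz
  obtain ⟨hX0, -, hSX, hXb⟩ := hX
  have hXinj : Function.Injective X := chart_injective hXb
  have hex : ∀ u ∈ nearBall, ∃ s, X s = z u := fun u hu => hSX _ (hzS u hu)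
  choose! σ hσ using hex
  have hadj : ∀ u ∈ nearBall, ∀ w ∈ nearBall,
      (dist (hcpSite 1 (Real.sqrt (2 / 3)) (σ u)) (hcpSite 1 (Real.sqrt (2 / 3)) (σ w)) = 1 ↔
        dist (hcpSite 1 (Real.sqrt (2 / 3)) u) (hcpSite 1 (Real.sqrt (2 / 3)) w) = 1) := fun u hu w hw => by
    rw [hXb, hσ u hu, hσ w hw, hzb u hu w hw]
  have hinj : Set.InjOn σ ↑nearBall := fun u hu w hw huw =>
    hzinj hu hw (by rw [← hσ u hu, ← hσ w hw]; exact congrArg X huw)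
  have h0 : σ 0 = 0 := hXinj (by rw [hσ 0 zero_mem_nearBall, hz0, hX0])
  have hN : ∀ ε ∈ hcpStarIdx, σ ε = ε := fun ε hε =>
    hXinj (by rw [hσ ε (mem_nearBall_of_mem_hcpStarIdx hε), hagree ε hε])
  intro u hu
  rw [← hσ u hu, eqOn_nearBall_of_fix_star hadj hinj h0 hN u hu]

end LocalChartIff

open RootedChartUnique LocalChartIff in
/-- **Registered sub-goal `tube_localChart_iff` — local charts on the near ball are exactly the restrictions of the
rooted charts.**  For an hcp-charted `S ∋ 0` (with good shells — not used), `z` is a local chart on the near ball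
(`IsLocalChart S z`) iff `z` agrees on `nearBall` with some rooted labelled chart `X` of `S`.  (→): with a rooted chart
`X₀` (`tube_exists_rootedChart`) the index map `X₀⁻¹ ∘ z` is, on the star, an automorphism of the contact graph of the
star, i.e. the restriction of an index automorphism `A t` (`exists_hcpIndexAut`, `exists_autCands_eqOn_star`-style);
`X₀ ∘ A t` is a rooted chart agreeing with `z` on the star, hence on the near ball (`localChart_eqOn_nearBall`).
(←): immediate, injectivity by `chart_injective`. [folklore] -/
theorem tube_localChart_iff : ∀ S : Set (EuclideanSpace ℝ (Fin 3)), (0 : EuclideanSpace ℝ (Fin 3)) ∈ S → (∀ x ∈ S, GoodShell S x) → HcpCharted S → ∀ z : ℤ × ℤ × ℤ → EuclideanSpace ℝ (Fin 3), IsLocalChart S z ↔ ∃ X : ℤ × ℤ × ℤ → EuclideanSpace ℝ (Fin 3), IsRootedChart S X ∧ ∀ u ∈ nearBall, z u = X u := by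
  intro S h0 _ hchart z
  constructor
  · intro hz
    obtain ⟨hz0, hzS, hzinj, hzb⟩ := id hz
    obtain ⟨X₀, hX0, hXS, hSX, hXc⟩ := tube_exists_rootedChart S h0 hchart
    have hinj : Function.Injective X₀ := chart_injective hXc
    obtain ⟨A, hA0, hAsurj, hAQ, -, hAB⟩ := exists_hcpIndexAut
    have hAaut : ∀ g ∈ autCands 12, ∃ t, ∀ m : Fin 12, starLab (g m) = A t (starLab m) := fun g hg => by
      simp only [List.all_eq_true, List.any_eq_true, decide_eq_true_eq] at hAB
      obtain ⟨t, -, ht⟩ := hAB g hg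
      exact ⟨t, fun m => ht m (mem_allLab m)⟩
    have hAadj : ∀ t u w,
        (dist (hcpSite 1 (Real.sqrt (2 / 3)) (A t u)) (hcpSite 1 (Real.sqrt (2 / 3)) (A t w)) = 1 ↔
          dist (hcpSite 1 (Real.sqrt (2 / 3)) u) (hcpSite 1 (Real.sqrt (2 / 3)) w) = 1) := fun t u w => by
      rw [dist_ideal_eq_one_iff, dist_ideal_eq_one_iff, hAQ]
    -- the index map `X₀⁻¹ ∘ z` on the near ball
    have hex : ∀ u ∈ nearBall, ∃ s, X₀ s = z u := fun u hu => hSX _ (hzS u hu)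
    choose! σ hσ using hex
    have hσadj : ∀ u ∈ nearBall, ∀ w ∈ nearBall,
        (dist (hcpSite 1 (Real.sqrt (2 / 3)) (σ u)) (hcpSite 1 (Real.sqrt (2 / 3)) (σ w)) = 1 ↔
          dist (hcpSite 1 (Real.sqrt (2 / 3)) u) (hcpSite 1 (Real.sqrt (2 / 3)) w) = 1) := fun u hu w hw => by
      rw [hXc, hσ u hu, hσ w hw, hzb u hu w hw]
    have hσinj : Set.InjOn σ ↑nearBall := fun u hu w hw huw =>
      hzinj hu hw (by rw [← hσ u hu, ← hσ w hw]; exact congrArg X₀ huw)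
    have hσ0 : σ 0 = 0 := hinj (by rw [hσ 0 zero_mem_nearBall, hz0, hX0])
    -- on the star it is an automorphism of the contact graph of the star
    have hmaps : ∀ δ ∈ hcpStarIdx, σ δ ∈ hcpStarIdx := fun δ hδ => by
      have hδN : δ ∈ nearBall := mem_nearBall_of_mem_hcpStarIdx hδ
      rw [mem_hcpStarIdx_iff_dist] at hδ ⊢
      rw [← hσ0, hσadj 0 zero_mem_nearBall δ hδN]
      exact hδ
    have hex' : ∀ m : Fin 12, ∃ n : Fin 12, starLab n = σ (starLab m) := fun m =>
      exists_starLab_eq (hmaps _ (starLab_mem m))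
    choose f hf using hex'
    have hfinj : Function.Injective f := fun m m' hmm' =>
      starLab_injective (hσinj (mem_nearBall_of_mem_hcpStarIdx (starLab_mem m))
        (mem_nearBall_of_mem_hcpStarIdx (starLab_mem m')) (by rw [← hf m, ← hf m', hmm']))
    have hfadj : ∀ m n, starAdjT (f m) (f n) = starAdjT m n := fun m n => by
      have key := hσadj (starLab m) (mem_nearBall_of_mem_hcpStarIdx (starLab_mem m)) (starLab n)
        (mem_nearBall_of_mem_hcpStarIdx (starLab_mem n))
      rw [← hf m, ← hf n, dist_ideal_eq_one_iff, dist_ideal_eq_one_iff] at key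
      rw [starAdjT_spec, starAdjT_spec, decide_eq_decide]
      exact key
    obtain ⟨g, hg, hgf⟩ := autCands_complete hfinj hfadj 12
    obtain ⟨t, ht⟩ := hAaut g hg
    -- the rooted chart `X₀ ∘ A t` agrees with `z` on the star
    have hXR : IsRootedChart S fun u => X₀ (A t u) :=
      ⟨by show X₀ (A t 0) = 0; rw [hA0, hX0], fun u => hXS _, fun y hy => by
        obtain ⟨u, rfl⟩ := hSX y hy
        obtain ⟨u', rfl⟩ := hAsurj t u
        exact ⟨u', rfl⟩,
       fun u w => by rw [← hAadj t]; exact hXc _ _⟩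
    refine ⟨fun u => X₀ (A t u), hXR, localChart_eqOn_nearBall hz hXR fun v hv => ?_⟩
    obtain ⟨m, rfl⟩ := exists_starLab_eq hv
    show z (starLab m) = X₀ (A t (starLab m))
    rw [← ht m, hgf m m.2, hf m, hσ _ (mem_nearBall_of_mem_hcpStarIdx (starLab_mem m))]
  · rintro ⟨X, ⟨hX0, hXS, -, hXb⟩, hzX⟩
    refine ⟨by rw [hzX 0 zero_mem_nearBall, hX0], fun u hu => by rw [hzX u hu]; exact hXS u,
      fun u hu w hw huw => ?_, fun u hu w hw => by rw [hzX u hu, hzX w hw]; exact hXb u w⟩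
    rw [hzX u hu, hzX w hw] at huw
    exact chart_injective hXb huw

end Summit.AtomisticToContinuum.Crystallization.Theorems.PalmUnimodularRigidity.LayeredLawsSelectHcp

end
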